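/-
Copyright: the b2b-balaban T⁴-continuum CRUX team, row NE7b OWNER lineage `t4-ne7b-p1` (gen 110). Project licence.
-/
import Summits.QuantumFields.BalabanUV.T4Continuum.Spine.NE7b.LogConcaveMarginalGrowth
import Mathlib.Analysis.InnerProductSpace.Calculus
import Mathlib.Analysis.Calculus.ContDiff.Defs
import Mathlib.MeasureTheory.Measure.Haar.InnerProductSpace
import Mathlib.MeasureTheory.Function.LocallyIntegrable
import Mathlib.Topology.Algebra.Module.FiniteDimension

/-!
# THE GROWTH LETTER OF ONE FLUCTUATION STEP, BY VALUE: the next action `ψ ↦ −log ∫_{K₂} e^{−V(φ) − G(ψ − Qφ)} dφ` grows about any `ψ₀`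
# at most like the fluctuation weight — `b⁺ = b` (`= a∕2` for the Gaussian `G = (a∕2)‖·‖²`), linear term = the tilted mean of `DG(ψ₀ − Q·)` —
# (29) `…LogConcaveMarginalGrowth` composed with the step form's slice letter; bounded window, no side letter (row NE7b, node U5c; family (2), (ℓ2))

Cell `pub-balaban`, sub-cell `t4`, spine estimate NE7b (`T4WeightBudget.RelWeightBound`; the cell's OWN estimate — NOT PRINTED in
[Bałaban 1983–89], NOT PROVED).  Crux-route work under `Spine/NE7b/` by the row's OWNER; NOTHING of Bałaban's is named or asserted; no
`T4Continuum/Support` leaf typed; no `def`; zero `sorry`.  Imports: the OWNER's (29) `…LogConcaveMarginalGrowth` (built) + Mathlib.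

WHY.  The companion (30) `…FluctuationStepModulus` gives the LOWER letter of the renormalisation-step exponent `U(ψ, φ) = V(φ) + G(ψ − Qφ)` by
value (`aσ∕(σ + aκ²)` in the kept variable), and (26) carries it through the fibre integral.  The road's sockets also consume the UPPER
(growth) letter (ℓ2) — `…ConvexWindowTaylorGrowth` ∕ `…ConvexWindowExponentShift` take a `b` with `W y ≤ W x₀ + ⟪∇W x₀, y − x₀⟫ + b‖y − x₀‖²`.
Through a step the upper letter is even simpler than the lower one: at a FIXED old field the step exponent is the fluctuation weight
translated, so its growth in `ψ` about `ψ₀` is `G`'s growth about `ψ₀ − Qφ` — constant `b`, linear term `DG(ψ₀ − Qφ)` — WHATEVER `V` is; and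
(29) (`neg_log_integral_le_of_base_growth`, Jensen under the tilted fibre law) says such a fibrewise letter survives `−log ∫ e^{−(·)}` with the
SAME `b` and the tilted mean of the linear terms.  THIS FILE is the composition with every side letter of (29) discharged on a bounded window
of positive volume (`V` continuous, `G ∈ C¹`): the next action's growth constant is the fluctuation weight's, by value.  With (30)∕(31): after
a Gaussian step the next action is pinched — modulus `≥ aσ∕(σ + aκ²)`, growth `≤ a∕2·‖·‖²` (Hessian between `aσ∕(σ + aκ²)` and `a` where it
exists).

WHAT IS PROVED ([folklore]):
* §1 `stepExponent_growth` — the slice letter: `G w' ≤ G w + dG w (w' − w) + b‖w' − w‖²` for all `w, w'` ⟹ for every old field `φ`: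
  `V φ + G(ψ − Qφ) ≤ (V φ + G(ψ₀ − Qφ)) + dG(ψ₀ − Qφ)(ψ − ψ₀) + b‖ψ − ψ₀‖²` (any real vector spaces; `V` arbitrary); `gaussian_growth_eq`
  (`G = (a∕2)‖·‖²`: the letter with `dG w = a • innerSL ℝ w`, `b = a∕2`, as an EQUALITY) and `hasFDerivAt_gaussian` (that `dG` IS the
  derivative).
* §2 **`neg_log_stepIntegral_le_of_growth`** — `K₂ ⊆ ℝⁿ` measurable, bounded, of positive volume; `V` continuous; `G ∈ C¹(ℝᵐ)` with the
  growth letter (`dG = fderiv ℝ G`, constant `b`); `Q : ℝⁿ →ₗ ℝᵐ` ⟹ for all `ψ₀, ψ`: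
  `V⁺ ψ ≤ V⁺ ψ₀ + D(ψ − ψ₀) + b‖ψ − ψ₀‖²`, `V⁺ = ψ ↦ −log ∫_{K₂} e^{−(V φ + G(ψ − Qφ))} dφ`,
  `D = (∫_{K₂} e^{−U(ψ₀,·)})⁻¹ • ∫_{K₂} e^{−U(ψ₀,φ)} • DG(ψ₀ − Qφ) dφ` (the tilted mean of the slice derivatives = `DV⁺(ψ₀)` by (28)
  `…LogConcaveMarginalDeriv`, not restated); the side letters `integrableOn_stepDensity'`, `stepIntegral_pos'`, `integrableOn_stepDensity_smul_fderiv`.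
* §3 **`neg_log_gaussianStepIntegral_le`** — the Gaussian fluctuation `G = (a∕2)‖·‖²`: `b = a∕2`, `DG(w) = a • innerSL ℝ w`, no hypothesis on
  `G` left.

NOT HERE (honest): which `V`, `G`, `Q`, `K₂` Bałaban's steps display ((A3) ∕ (A1c); NC-NE7b-α UNRULED); the identification `D = ∇V⁺(ψ₀)` ((28));
the lower letter ((30) ∕ (26)); anything of Bałaban's.  BY-NAME EFFECT ON THE WALL: NONE.  NE7b NOT PRINTED ∕ NOT PROVED; spine PROVED 0∕9; rung
(B)+1 on a FINITE torus — NOT infinite volume, NOT the mass gap, NOT Clay.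
HONEST DEPENDENCY: continuum YM on T⁴ ⇐ BetaPertH ∧ nine spine estimates (0/9 proved); BetaPertH ⇐ (D1) ∧ (D4) ∧ CAP+tail.
-/

set_option autoImplicit false

noncomputable section

open MeasureTheory Real Set Bornology
open scoped RealInnerProductSpace
open Summit.QuantumFields.BalabanUV.T4Continuum.NE7b.LogConcaveMarginalGrowth

namespace Summit.QuantumFields.BalabanUV.T4Continuum.NE7b.FluctuationStepGrowth

/-! ## §1 The slice letter of the step exponent, and the Gaussian fluctuation weight -/

section Slice

variable {E₁ : Type*} [NormedAddCommGroup E₁] [NormedSpace ℝ E₁] {E₂ : Type*} [AddCommGroup E₂] [Module ℝ E₂]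

/-- **THE SLICE GROWTH LETTER OF THE STEP EXPONENT.**  If the fluctuation weight obeys `G w' ≤ G w + dG w (w' − w) + b‖w' − w‖²` for all
`w, w'`, then at every fixed old field `φ` the step exponent `ψ ↦ V φ + G(ψ − Qφ)` obeys the same letter about any `ψ₀` with linear term
`dG(ψ₀ − Qφ)` and the SAME constant `b` — whatever `V` is (the shape of (29)'s hypothesis `hgrowth`). [folklore] -/
theorem stepExponent_growth {G : E₁ → ℝ} {dG : E₁ → (E₁ →L[ℝ] ℝ)} {b : ℝ}
    (hGs : ∀ w w', G w' ≤ G w + dG w (w' - w) + b * ‖w' - w‖ ^ 2) (V : E₂ → ℝ) (Q : E₂ →ₗ[ℝ] E₁)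
    (x₀ x : E₁) (y : E₂) :
    V y + G (x - Q y) ≤ (V y + G (x₀ - Q y)) + dG (x₀ - Q y) (x - x₀) + b * ‖x - x₀‖ ^ 2 := by
  have h := hGs (x₀ - Q y) (x - Q y)
  rw [sub_sub_sub_cancel_right] at h
  linarith

end Slice

section Gaussian

variable {E : Type*} [NormedAddCommGroup E] [InnerProductSpace ℝ E]

/-- **THE GAUSSIAN FLUCTUATION WEIGHT** `G = (a∕2)‖·‖²` obeys the growth letter with `dG w = a • innerSL ℝ w` and `b = a∕2`, as an EQUALITY:
`(a∕2)‖w'‖² = (a∕2)‖w‖² + a⟪w, w' − w⟫ + (a∕2)‖w' − w‖²`. [folklore] -/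
theorem gaussian_growth_eq (a : ℝ) (w w' : E) :
    a / 2 * ‖w'‖ ^ 2 = a / 2 * ‖w‖ ^ 2 + (a • innerSL ℝ w) (w' - w) + a / 2 * ‖w' - w‖ ^ 2 := by
  simp only [smul_apply, innerSL_apply_apply, smul_eq_mul, inner_sub_right, real_inner_self_eq_norm_sq]
  rw [norm_sub_sq_real, real_inner_comm w w']
  ring

/-- The Gaussian weight's growth letter in the `≤` shape of `stepExponent_growth` (`b = a∕2`). [folklore] -/
theorem gaussian_growth (a : ℝ) (w w' : E) :
    a / 2 * ‖w'‖ ^ 2 ≤ a / 2 * ‖w‖ ^ 2 + (a • innerSL ℝ w) (w' - w) + a / 2 * ‖w' - w‖ ^ 2 :=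
  (gaussian_growth_eq a w w').le

/-- `a • innerSL ℝ w` IS the derivative of `(a∕2)‖·‖²` at `w`. [folklore] -/
theorem hasFDerivAt_gaussian (a : ℝ) (w : E) : HasFDerivAt (fun v : E => a / 2 * ‖v‖ ^ 2) (a • innerSL ℝ w) w := by
  refine (((hasStrictFDerivAt_norm_sq w).hasFDerivAt).const_mul (a / 2)).congr_fderiv ?_
  ext v
  simp only [smul_apply, smul_eq_mul, nsmul_eq_mul, Nat.cast_ofNat, innerSL_apply_apply]
  ring

/-- Hence `fderiv ℝ (a∕2‖·‖²) w = a • innerSL ℝ w` and the weight is `C¹`. [folklore] -/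
theorem fderiv_gaussian (a : ℝ) (w : E) : fderiv ℝ (fun v : E => a / 2 * ‖v‖ ^ 2) w = a • innerSL ℝ w :=
  (hasFDerivAt_gaussian a w).fderiv

/-- The Gaussian weight is `C¹` (indeed smooth). [folklore] -/
theorem contDiff_gaussian (a : ℝ) : ContDiff ℝ 1 fun v : E => a / 2 * ‖v‖ ^ 2 :=
  (contDiff_const.mul (contDiff_norm_sq ℝ)).of_le le_top

end Gaussian

/-! ## §2 The composition with (29) on a bounded window: the next action's growth letter, by value -/

section Window

variable {m n : ℕ}

/-- `hint` for the step at a base point (bounded window, continuous data). [folklore] -/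
theorem integrableOn_stepDensity' {K₂ : Set (EuclideanSpace ℝ (Fin n))} (hK₂b : IsBounded K₂)
    {V : EuclideanSpace ℝ (Fin n) → ℝ} {G : EuclideanSpace ℝ (Fin m) → ℝ} (hVc : Continuous V) (hGc : Continuous G)
    (Q : EuclideanSpace ℝ (Fin n) →ₗ[ℝ] EuclideanSpace ℝ (Fin m)) (x : EuclideanSpace ℝ (Fin m)) :
    IntegrableOn (fun y => exp (-(V y + G (x - Q y)))) K₂ := by
  have hc : Continuous fun y => exp (-(V y + G (x - Q y))) :=
    continuous_exp.comp (hVc.add (hGc.comp (continuous_const.sub Q.continuous_of_finiteDimensional))).neg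
  exact (hc.continuousOn.integrableOn_compact hK₂b.isCompact_closure).mono_set subset_closure

/-- `hpos` for the step at a base point (bounded window of positive volume, continuous data). [folklore] -/
theorem stepIntegral_pos' {K₂ : Set (EuclideanSpace ℝ (Fin n))} (hK₂b : IsBounded K₂) (hK₂v : 0 < volume K₂)
    {V : EuclideanSpace ℝ (Fin n) → ℝ} {G : EuclideanSpace ℝ (Fin m) → ℝ} (hVc : Continuous V) (hGc : Continuous G)
    (Q : EuclideanSpace ℝ (Fin n) →ₗ[ℝ] EuclideanSpace ℝ (Fin m)) (x : EuclideanSpace ℝ (Fin m)) :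
    0 < ∫ y in K₂, exp (-(V y + G (x - Q y))) := by
  haveI : NeZero (volume.restrict K₂ : Measure (EuclideanSpace ℝ (Fin n))) :=
    ⟨fun h => hK₂v.ne' (Measure.restrict_eq_zero.1 h)⟩
  exact integral_exp_pos (integrableOn_stepDensity' hK₂b hVc hGc Q x)

/-- The tilted-mean integrand `φ ↦ e^{−U(ψ₀,φ)} • DG(ψ₀ − Qφ)` is integrable on a bounded window for continuous `V` and `G ∈ C¹`. [folklore] -/
theorem integrableOn_stepDensity_smul_fderiv {K₂ : Set (EuclideanSpace ℝ (Fin n))} (hK₂b : IsBounded K₂)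
    {V : EuclideanSpace ℝ (Fin n) → ℝ} {G : EuclideanSpace ℝ (Fin m) → ℝ} (hVc : Continuous V) (hG1 : ContDiff ℝ 1 G)
    (Q : EuclideanSpace ℝ (Fin n) →ₗ[ℝ] EuclideanSpace ℝ (Fin m)) (x₀ : EuclideanSpace ℝ (Fin m)) :
    IntegrableOn (fun y => exp (-(V y + G (x₀ - Q y))) • fderiv ℝ G (x₀ - Q y)) K₂ := by
  have hGc : Continuous G := hG1.continuous
  have hdGc : Continuous (fderiv ℝ G) := (contDiff_one_iff_fderiv.1 hG1).2
  have hQc : Continuous fun y : EuclideanSpace ℝ (Fin n) => x₀ - Q y := continuous_const.sub Q.continuous_of_finiteDimensional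
  have hc : Continuous fun y => exp (-(V y + G (x₀ - Q y))) • fderiv ℝ G (x₀ - Q y) :=
    (continuous_exp.comp (hVc.add (hGc.comp hQc)).neg).smul (hdGc.comp hQc)
  exact (hc.continuousOn.integrableOn_compact hK₂b.isCompact_closure).mono_set subset_closure

/-- **THE GROWTH LETTER OF THE NEXT ACTION, BY VALUE.**  `K₂ ⊆ ℝⁿ` measurable, bounded, of positive volume; `V : ℝⁿ → ℝ` continuous (the
incoming action — NO convexity needed for this letter); `G : ℝᵐ → ℝ` of class `C¹` with the growth letter
`G w' ≤ G w + DG(w)(w' − w) + b‖w' − w‖²`; `Q : ℝⁿ →ₗ ℝᵐ`.  Then for all new fields `ψ₀, ψ`, with `U(ψ, φ) = V φ + G(ψ − Qφ)` and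
`V⁺ ψ = −log ∫_{K₂} e^{−U(ψ,φ)} dφ`:
`V⁺ ψ ≤ V⁺ ψ₀ + D(ψ − ψ₀) + b‖ψ − ψ₀‖²`, `D = (∫_{K₂} e^{−U(ψ₀,·)})⁻¹ • ∫_{K₂} e^{−U(ψ₀,φ)} • DG(ψ₀ − Qφ) dφ` — the next action's growth constant
is the fluctuation weight's ((29) `neg_log_integral_le_of_base_growth` BY NAME on `volume.restrict K₂`, all its side letters discharged). [folklore] -/
theorem neg_log_stepIntegral_le_of_growth {K₂ : Set (EuclideanSpace ℝ (Fin n))} (hK₂b : IsBounded K₂) (hK₂v : 0 < volume K₂)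
    {V : EuclideanSpace ℝ (Fin n) → ℝ} {G : EuclideanSpace ℝ (Fin m) → ℝ} (hVc : Continuous V) (hG1 : ContDiff ℝ 1 G) {b : ℝ}
    (hGs : ∀ w w', G w' ≤ G w + fderiv ℝ G w (w' - w) + b * ‖w' - w‖ ^ 2)
    (Q : EuclideanSpace ℝ (Fin n) →ₗ[ℝ] EuclideanSpace ℝ (Fin m)) (x₀ x : EuclideanSpace ℝ (Fin m)) :
    -log (∫ y in K₂, exp (-(V y + G (x - Q y)))) ≤
      -log (∫ y in K₂, exp (-(V y + G (x₀ - Q y)))) +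
        (((∫ y in K₂, exp (-(V y + G (x₀ - Q y))))⁻¹ •
            ∫ y in K₂, exp (-(V y + G (x₀ - Q y))) • fderiv ℝ G (x₀ - Q y)) (x - x₀) + b * ‖x - x₀‖ ^ 2) := by
  have hGc : Continuous G := hG1.continuous
  have hdGc : Continuous (fderiv ℝ G) := (contDiff_one_iff_fderiv.1 hG1).2
  have hQc : Continuous fun y : EuclideanSpace ℝ (Fin n) => x₀ - Q y := continuous_const.sub Q.continuous_of_finiteDimensional
  exact neg_log_integral_le_of_base_growth (μ := volume.restrict K₂)
    (V := fun p : EuclideanSpace ℝ (Fin m) × EuclideanSpace ℝ (Fin n) => V p.2 + G (p.1 - Q p.2))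
    (Vx := fun p : EuclideanSpace ℝ (Fin m) × EuclideanSpace ℝ (Fin n) => fderiv ℝ G (p.1 - Q p.2))
    (hVc.add (hGc.comp hQc)).aestronglyMeasurable (hdGc.comp hQc).aestronglyMeasurable
    (integrableOn_stepDensity' hK₂b hVc hGc Q x₀) (integrableOn_stepDensity' hK₂b hVc hGc Q x)
    (integrableOn_stepDensity_smul_fderiv hK₂b hVc hG1 Q x₀) (stepIntegral_pos' hK₂b hK₂v hVc hGc Q x₀)
    (fun y => stepExponent_growth hGs V Q x₀ x y)

end Window

/-! ## §3 The Gaussian fluctuation: no hypothesis on the weight left -/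

section GaussianWindow

variable {m n : ℕ}

/-- **THE GAUSSIAN STEP's GROWTH LETTER.**  `K₂ ⊆ ℝⁿ` bounded of positive volume, `V` continuous, `Q : ℝⁿ →ₗ ℝᵐ`, `a : ℝ`, `G = (a∕2)‖·‖²`.
Then for all `ψ₀, ψ`: `V⁺ ψ ≤ V⁺ ψ₀ + D(ψ − ψ₀) + (a∕2)‖ψ − ψ₀‖²` with
`D = (∫_{K₂} e^{−U(ψ₀,·)})⁻¹ • ∫_{K₂} e^{−U(ψ₀,φ)} • (a • innerSL ℝ (ψ₀ − Qφ)) dφ` (i.e. `D(v) = a⟪ψ₀ − Q φ̄, v⟫`, `φ̄` the tilted mean of the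
old field) — the next action's growth constant after a Gaussian step is `a∕2`, whatever the incoming action. [folklore] -/
theorem neg_log_gaussianStepIntegral_le {K₂ : Set (EuclideanSpace ℝ (Fin n))} (hK₂b : IsBounded K₂) (hK₂v : 0 < volume K₂)
    {V : EuclideanSpace ℝ (Fin n) → ℝ} (hVc : Continuous V) (a : ℝ)
    (Q : EuclideanSpace ℝ (Fin n) →ₗ[ℝ] EuclideanSpace ℝ (Fin m)) (x₀ x : EuclideanSpace ℝ (Fin m)) :
    -log (∫ y in K₂, exp (-(V y + a / 2 * ‖x - Q y‖ ^ 2))) ≤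
      -log (∫ y in K₂, exp (-(V y + a / 2 * ‖x₀ - Q y‖ ^ 2))) +
        (((∫ y in K₂, exp (-(V y + a / 2 * ‖x₀ - Q y‖ ^ 2)))⁻¹ •
            ∫ y in K₂, exp (-(V y + a / 2 * ‖x₀ - Q y‖ ^ 2)) • (a • innerSL ℝ (x₀ - Q y))) (x - x₀) + a / 2 * ‖x - x₀‖ ^ 2) := by
  have h := neg_log_stepIntegral_le_of_growth (G := fun v : EuclideanSpace ℝ (Fin m) => a / 2 * ‖v‖ ^ 2) hK₂b hK₂v hVc
    (contDiff_gaussian a) (b := a / 2) (fun w w' => by rw [fderiv_gaussian]; exact gaussian_growth a w w') Q x₀ x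
  simp only [fderiv_gaussian] at h
  exact h

end GaussianWindow

/-! ## §4 Sanity (decided toy) -/

/-- Toy: for a Gaussian step with `a = 2` the growth constant of the next action is `1 = a∕2`, and together with (30)'s lower letter at
`σ = 2`, `κ = 1` (outgoing modulus `aσ∕(σ+aκ²) = 1`) the next action of the Gaussian pair is pinched to the single number `1`. -/
example : (2 : ℝ) / 2 = 1 ∧ (2 : ℝ) * 2 / (2 + 2 * 1 ^ 2) = 1 := by norm_num

end Summit.QuantumFields.BalabanUV.T4Continuum.NE7b.FluctuationStepGrowth
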